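import Summits.Ventures.AbcSig.Rows.StatementsC1b
import Summits.Ventures.AbcSig.Rows.Xn8Yn29Z2X

/-!
# Venture AbcSig — CELL bridge for `xⁿ + 8 yⁿ = 29 z²`: p1's census predicate `Rows.C1bCell 29 (fun _ α => α = 3) 11 ∅`

HONEST FRAMING. COMPUTATION cell `pub-abcsig`; CONDITIONAL theorem; no claim on ABC or any summit. Hypotheses exactly
those of `Rows/Xn8Yn29Z2X.lean` (`xrow_Xn8Yn29Z2`): `BS04Package` (CITED), `DataComplete` / `RefinesCPSymAll` (COMPUTED,
certified engine level files; norm-form certificates `Sieve/CharpolyCert.lean`), and the row's per-orbit CITED exclusions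
`hX_…` universally quantified in the exponent. Conclusion = p1's statement of the SIGNED row of record
`census/rows/C1b/C1b-C29-a3.md` (sha16 `19b2f7896f2bf050`) in the census vocabulary
(`Rows/Statements.lean`, `Rows/StatementsC1b.lean`). GENERATED by p-lean g4 `gen4/cprow.py` (pattern of `Rows/XnYn14Z2XCell.lean`).
-/

namespace Summit.Ventures.AbcSig

/-- `xⁿ + 8 yⁿ = 29 z²`: p1's `Rows.C1bCell 29 (fun _ α => α = 3) 11 ∅` from `xrow_Xn8Yn29Z2` (hypotheses as there, `hX_…` for every exponent). -/
theorem C1bCell_29_a3_of (M : NewformModel) (hP : M.BS04Package)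
    (hD1682 : M.DataComplete 1682 level1682Orbits)
    (hD26912 : M.DataComplete 26912 level26912Orbits) (hCP26912 : M.RefinesCPSymAll 26912 level26912CP)
    (hX_orbit_26912_1 : ∀ n : ℕ, n ∈ ([11] : List ℕ) → M.Excludes 26912 orbit_26912_1 (famBC 3 29 n (fun _ b => ¬ 2 ∣ b)))
    (hX_orbit_26912_2 : ∀ n : ℕ, n ∈ ([11] : List ℕ) → M.Excludes 26912 orbit_26912_2 (famBC 3 29 n (fun _ b => ¬ 2 ∣ b)))
    (hX_orbit_26912_4 : ∀ n : ℕ, M.Excludes 26912 orbit_26912_4 (famBC 3 29 n (fun _ b => ¬ 2 ∣ b)))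
    (hX_orbit_26912_5 : ∀ n : ℕ, M.Excludes 26912 orbit_26912_5 (famBC 3 29 n (fun _ b => ¬ 2 ∣ b)))
    (hX_orbit_26912_6 : ∀ n : ℕ, M.Excludes 26912 orbit_26912_6 (famBC 3 29 n (fun _ b => ¬ 2 ∣ b)))
    (hX_orbit_26912_8 : ∀ n : ℕ, n ∈ ([11] : List ℕ) → M.Excludes 26912 orbit_26912_8 (famBC 3 29 n (fun _ b => ¬ 2 ∣ b)))
    (hX_orbit_26912_9 : ∀ n : ℕ, n ∈ ([11] : List ℕ) → M.Excludes 26912 orbit_26912_9 (famBC 3 29 n (fun _ b => ¬ 2 ∣ b)))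
    (hX_orbit_26912_30 : ∀ n : ℕ, n ∈ ([13] : List ℕ) → M.Excludes 26912 orbit_26912_30 (famBC 3 29 n (fun _ b => ¬ 2 ∣ b)))
    (hX_orbit_26912_31 : ∀ n : ℕ, n ∈ ([13] : List ℕ) → M.Excludes 26912 orbit_26912_31 (famBC 3 29 n (fun _ b => ¬ 2 ∣ b))) :
    Rows.C1bCell 29 (fun _ α => α = 3) 11 ∅ := by
  intro n hn h11 hC _ α hα x y z h1 h2
  subst hα
  exact xrow_Xn8Yn29Z2 M hP hD1682 hD26912 hCP26912 n hn h11  hC (hX_orbit_26912_1 n) (hX_orbit_26912_2 n) (hX_orbit_26912_4 n) (hX_orbit_26912_5 n) (hX_orbit_26912_6 n) (hX_orbit_26912_8 n) (hX_orbit_26912_9 n) (hX_orbit_26912_30 n) (hX_orbit_26912_31 n) x y z h1 h2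

end Summit.Ventures.AbcSig
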